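import Summits.Ventures.LatticeQCDFlow.Exactness.Phi4MetropolisPositive
import HarnessLib

/-!
# Positive-definite step laws form a convex cone: MIXTURES of Gaussian steps of several widths keep the local arm positive

HONEST FRAMING: exact (Metropolis-corrected) sampling algorithms for lattice gauge theory;
figures of merit are autocorrelation/cost numbers at stated couplings and volumes; no
continuum-physics claim.  (SCALAR calibration rung S0-A: not a gauge result.)

Venture `LatticeQCDFlow` (cell pub-lqcd), topic `Exactness`; FANOUT row 2 (`s0-phi4`, LOCAL arm).
NEW WORK of the cell over `Exactness/MetropolisLinePositive.lean` (`integrable_shear`),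
`Exactness/ConvolutionSquarePosDef.lean` (`gaussian_posDef`) and `Exactness/Phi4MetropolisPositive.lean`
(`metroScan_positive_poly`).  Nothing is cited as a fact.  Multi-scale proposals — a random choice
between a small and a large Gaussian step — are the practical form of the local arm; this file says
they keep the positivity of `Exactness/Phi4MetropolisPositive.lean` and hence every monotonicity
consequence of `Exactness/Phi4MetropolisGaussianMonotone.lean` (restated here for the mixture only as
positivity; the consequences follow verbatim from `ReversiblePositive{,TauInt,Thinning}`).

## What is proved

* **`posDef_add`** — if `ρ₁`, `ρ₂` (integrable, `≥ 0`) are positive definite in the integrated sense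
  (`0 ≤ ∫∫ G G ρᵢ(t'−t)` for measurable integrable bounded `G`) then so is `a ρ₁ + b ρ₂` for
  `a, b ≥ 0` (the double integrals split: sheared products are integrable);
* `gaussianMixture_nonneg/measurable/integrable/integral/even/moments/posDef` — the two-width
  Gaussian mixture `a N(0,v₁) + (1 − a) N(0,v₂)` (`a ∈ [0,1]`, `v₁, v₂ ≠ 0`) is an admissible even
  step law with all moments, positive definite;
* **`metroScan_gaussianMixture_positive_poly`** — LATTICE: coercive action (every `λ > 0`, real `J`),
  step law `a N(0,v₁) + (1 − a) N(0,v₂)`: the random-site Metropolis scan is a POSITIVE operator on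
  `PolyObs`, `0 ≤ ∫ f (K f) e^{−S}`.

NOT CLAIMED: mixtures with a uniform-window component; any number for any run.
-/

namespace Summit.Ventures.LatticeQCDFlow.Exactness

open Real MeasureTheory Filter Finset ProbabilityTheory
open scoped NNReal
open Summit.Ventures.LatticeQCDFlow.Scoring

section Line

/-- **Positive-definite step laws form a convex cone**: `a ρ₁ + b ρ₂` (`a, b ≥ 0`) is positive
definite in the integrated sense when `ρ₁`, `ρ₂` are. -/
theorem posDef_add {ρ₁ ρ₂ : ℝ → ℝ} (hρ₁0 : ∀ u, 0 ≤ ρ₁ u) (hρ₁m : Measurable ρ₁)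
    (hρ₁i : Integrable ρ₁) (hρ₂0 : ∀ u, 0 ≤ ρ₂ u) (hρ₂m : Measurable ρ₂) (hρ₂i : Integrable ρ₂)
    (hpd₁ : ∀ ⦃G : ℝ → ℝ⦄, Measurable G → Integrable G → ∀ ⦃C : ℝ⦄, (∀ t, |G t| ≤ C) →
      0 ≤ ∫ t, ∫ t', G t * G t' * ρ₁ (t' - t))
    (hpd₂ : ∀ ⦃G : ℝ → ℝ⦄, Measurable G → Integrable G → ∀ ⦃C : ℝ⦄, (∀ t, |G t| ≤ C) →
      0 ≤ ∫ t, ∫ t', G t * G t' * ρ₂ (t' - t))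
    {a b : ℝ} (ha : 0 ≤ a) (hb : 0 ≤ b) :
    ∀ ⦃G : ℝ → ℝ⦄, Measurable G → Integrable G → ∀ ⦃C : ℝ⦄, (∀ t, |G t| ≤ C) →
      0 ≤ ∫ t, ∫ t', G t * G t' * (a * ρ₁ (t' - t) + b * ρ₂ (t' - t)) := by
  intro G hGm hGi C hGb
  have hS₁ := integrable_shear hGm hGi hGm hGb hρ₁0 hρ₁m hρ₁i
  have hS₂ := integrable_shear hGm hGi hGm hGb hρ₂0 hρ₂m hρ₂i
  -- inner split, pointwise in `t`
  have hin₁ : ∀ t, Integrable (fun t' => G t * G t' * ρ₁ (t' - t)) := by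
    intro t
    refine Integrable.mono' ((hρ₁i.comp_sub_right t).const_mul (|G t| * C))
      (((measurable_const.mul hGm).mul (hρ₁m.comp (measurable_id.sub_const t))).aestronglyMeasurable)
      (Eventually.of_forall fun t' => ?_)
    rw [Real.norm_eq_abs, abs_mul, abs_mul, abs_of_nonneg (hρ₁0 _)]
    gcongr
    · exact hρ₁0 _
    · exact hGb t'
  have hin₂ : ∀ t, Integrable (fun t' => G t * G t' * ρ₂ (t' - t)) := by
    intro t
    refine Integrable.mono' ((hρ₂i.comp_sub_right t).const_mul (|G t| * C))
      (((measurable_const.mul hGm).mul (hρ₂m.comp (measurable_id.sub_const t))).aestronglyMeasurable)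
      (Eventually.of_forall fun t' => ?_)
    rw [Real.norm_eq_abs, abs_mul, abs_mul, abs_of_nonneg (hρ₂0 _)]
    gcongr
    · exact hρ₂0 _
    · exact hGb t'
  have e : ∀ t, ∫ t', G t * G t' * (a * ρ₁ (t' - t) + b * ρ₂ (t' - t))
      = a * (∫ t', G t * G t' * ρ₁ (t' - t)) + b * ∫ t', G t * G t' * ρ₂ (t' - t) := by
    intro t
    have e1 : ∀ t', G t * G t' * (a * ρ₁ (t' - t) + b * ρ₂ (t' - t))
        = a * (G t * G t' * ρ₁ (t' - t)) + b * (G t * G t' * ρ₂ (t' - t)) := fun t' => by ring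
    simp_rw [e1]
    rw [integral_add ((hin₁ t).const_mul a) ((hin₂ t).const_mul b), integral_const_mul,
      integral_const_mul]
  simp_rw [e]
  rw [integral_add (hS₁.integral_prod_left.const_mul a) (hS₂.integral_prod_left.const_mul b),
    integral_const_mul, integral_const_mul]
  exact add_nonneg (mul_nonneg ha (hpd₁ hGm hGi hGb)) (mul_nonneg hb (hpd₂ hGm hGi hGb))

/-! ## The two-width Gaussian mixture `a N(0,v₁) + (1 − a) N(0,v₂)` -/

/-- Nonnegativity of the Gaussian mixture. -/
theorem gaussianMixture_nonneg (v₁ v₂ : ℝ≥0) {a : ℝ} (ha0 : 0 ≤ a) (ha1 : a ≤ 1) (u : ℝ) :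
    0 ≤ a * gaussianPDFReal 0 v₁ u + (1 - a) * gaussianPDFReal 0 v₂ u :=
  add_nonneg (mul_nonneg ha0 (gaussianPDFReal_nonneg 0 v₁ u))
    (mul_nonneg (sub_nonneg.2 ha1) (gaussianPDFReal_nonneg 0 v₂ u))

/-- Measurability of the Gaussian mixture. -/
theorem gaussianMixture_measurable (v₁ v₂ : ℝ≥0) (a : ℝ) :
    Measurable fun u => a * gaussianPDFReal 0 v₁ u + (1 - a) * gaussianPDFReal 0 v₂ u :=
  (measurable_const.mul (measurable_gaussianPDFReal 0 v₁)).add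
    (measurable_const.mul (measurable_gaussianPDFReal 0 v₂))

/-- Integrability of the Gaussian mixture. -/
theorem gaussianMixture_integrable (v₁ v₂ : ℝ≥0) (a : ℝ) :
    Integrable fun u => a * gaussianPDFReal 0 v₁ u + (1 - a) * gaussianPDFReal 0 v₂ u :=
  ((integrable_gaussianPDFReal 0 v₁).const_mul a).add ((integrable_gaussianPDFReal 0 v₂).const_mul _)

/-- The Gaussian mixture is a probability density. -/
theorem gaussianMixture_integral {v₁ v₂ : ℝ≥0} (hv₁ : v₁ ≠ 0) (hv₂ : v₂ ≠ 0) (a : ℝ) :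
    ∫ u, (a * gaussianPDFReal 0 v₁ u + (1 - a) * gaussianPDFReal 0 v₂ u) = 1 := by
  rw [integral_add ((integrable_gaussianPDFReal 0 v₁).const_mul a)
    ((integrable_gaussianPDFReal 0 v₂).const_mul _), integral_const_mul, integral_const_mul,
    integral_gaussianPDFReal_eq_one 0 hv₁, integral_gaussianPDFReal_eq_one 0 hv₂]
  ring

/-- The Gaussian mixture is even. -/
theorem gaussianMixture_even (v₁ v₂ : ℝ≥0) (a u : ℝ) :
    a * gaussianPDFReal 0 v₁ (-u) + (1 - a) * gaussianPDFReal 0 v₂ (-u)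
      = a * gaussianPDFReal 0 v₁ u + (1 - a) * gaussianPDFReal 0 v₂ u := by
  rw [gaussianPDFReal_zero_neg, gaussianPDFReal_zero_neg]

/-- The Gaussian mixture has all moments. -/
theorem gaussianMixture_moments {v₁ v₂ : ℝ≥0} (hv₁ : v₁ ≠ 0) (hv₂ : v₂ ≠ 0) (a : ℝ) (j : ℕ) :
    Integrable fun u => (1 + |u|) ^ j * (a * gaussianPDFReal 0 v₁ u + (1 - a) * gaussianPDFReal 0 v₂ u) := by
  have h := ((gaussianPDFReal_moments hv₁ j).const_mul a).add
    ((gaussianPDFReal_moments hv₂ j).const_mul (1 - a))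
  refine h.congr (Eventually.of_forall fun u => ?_)
  simp only [Pi.add_apply]
  ring

/-- **The two-width Gaussian mixture is positive definite** (`a ∈ [0,1]`, `v₁, v₂ ≠ 0`). -/
theorem gaussianMixture_posDef {v₁ v₂ : ℝ≥0} (hv₁ : v₁ ≠ 0) (hv₂ : v₂ ≠ 0) {a : ℝ} (ha0 : 0 ≤ a)
    (ha1 : a ≤ 1) :
    ∀ ⦃G : ℝ → ℝ⦄, Measurable G → Integrable G → ∀ ⦃C : ℝ⦄, (∀ t, |G t| ≤ C) →
      0 ≤ ∫ t, ∫ t', G t * G t'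
        * (a * gaussianPDFReal 0 v₁ (t' - t) + (1 - a) * gaussianPDFReal 0 v₂ (t' - t)) :=
  posDef_add (fun u => gaussianPDFReal_nonneg 0 v₁ u) (measurable_gaussianPDFReal 0 v₁)
    (integrable_gaussianPDFReal 0 v₁) (fun u => gaussianPDFReal_nonneg 0 v₂ u)
    (measurable_gaussianPDFReal 0 v₂) (integrable_gaussianPDFReal 0 v₂)
    (fun _ hGm hGi _ _ => gaussian_posDef hv₁ hGm hGi)
    (fun _ hGm hGi _ _ => gaussian_posDef hv₂ hGm hGi) ha0 (sub_nonneg.2 ha1)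

end Line

/-! ## Lattice φ⁴ -/

section Lattice

variable {n : ℕ}

/-- **THE LOCAL ARM WITH A TWO-WIDTH GAUSSIAN MIXTURE STEP LAW IS A POSITIVE OPERATOR ON `PolyObs`**
(coercive action — every `λ > 0`, real `J`; step law `a N(0,v₁) + (1 − a) N(0,v₂)`, `a ∈ [0,1]`,
`v₁, v₂ ≠ 0`): `0 ≤ ∫ f (K f) e^{−S}` for every `f ∈ PolyObs`. -/
theorem metroScan_gaussianMixture_positive_poly {J : Fin (n + 1) → Fin (n + 1) → ℝ} {lam ε K : ℝ}
    (hε : 0 < ε) (hS : ∀ φ : Fin (n + 1) → ℝ, ε * ∑ w, φ w ^ 2 - K ≤ latticePhi4Action J lam φ)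
    {v₁ v₂ : ℝ≥0} (hv₁ : v₁ ≠ 0) (hv₂ : v₂ ≠ 0) {a : ℝ} (ha0 : 0 ≤ a) (ha1 : a ≤ 1)
    {f : (Fin (n + 1) → ℝ) → ℝ} (hf : PolyObs f) :
    0 ≤ ∫ φ, f φ * metroScan J lam
        (fun u => a * gaussianPDFReal 0 v₁ u + (1 - a) * gaussianPDFReal 0 v₂ u) f φ
        * gibbsWeight J lam φ :=
  metroScan_positive_poly hε hS (gaussianMixture_nonneg v₁ v₂ ha0 ha1)
    (gaussianMixture_measurable v₁ v₂ a) (gaussianMixture_integrable v₁ v₂ a)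
    (gaussianMixture_integral hv₁ hv₂ a) (gaussianMixture_moments hv₁ hv₂ a)
    (gaussianMixture_posDef hv₁ hv₂ ha0 ha1) hf

end Lattice

end Summit.Ventures.LatticeQCDFlow.Exactness
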